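import Literature.Probability.LatticeModels.FKIsingRSWPairSum
import Literature.Probability.LatticeModels.FKIsingAnnulusCrossingProofs
import Literature.Probability.LatticeModels.RandomClusterRegionToAnnulus
import Mathlib.Analysis.SpecialFunctions.Pow.Real
import Mathlib.Analysis.Convex.SpecificFunctions.Basic
import HarnessLib

/-!
# RSW for the critical FK-Ising model from the half-plane arm bounds (DCHN Lemma 15)

Topic `Literature/Probability/LatticeModels`; part of the discharge programme for the named fact
`fkIsing_rsw` (`FKIsingRSW.lean`: Duminil-Copin–Hongler–Nolin 2011, Thm. 1 for free boundary
conditions = Duminil-Copin–Smirnov 2012, Thm. 3.16). Theorems, and definitions of events and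
regions only; no named fact is introduced and nothing assumes `fkIsing_rsw`.

## The reduction

With Prop. 13 of DCHN proved in the tree (`LatticeDobrushin.fkIsing_connection_lower_bound`,
`FKIsingRSWFirstMoment.lean`) and the second-moment glue `fkIsing_rsw_of_pair_sum`
(`FKIsingRSWPairSum.lean`), `fkIsing_rsw` follows from one estimate: the summed two-point bound
`Σ_{i,j ≤ n} φ^{side}_H((0,i) ↔ side, (0,j) ↔ side) ≤ C n` on the half `H = [0, 2n] × [0, n]` with
its far side wired (DCHN, Prop. 14 summed). DCHN prove Prop. 14 by an exploration argument in
random slit domains; here it is **deduced from two one-arm bounds in fixed domains** by a decoupling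
(two successive conditionings, Duminil-Copin–Smirnov 2012, §6.1; Grimmett 2006, Lemma (4.14)(b)).
Let `T_N = [0, N] × [0, 2N]` be the three-sided box with its far side `{x₀ = N}` and its lateral
sides `{x₁ = 0}`, `{x₁ = 2N}` wired and its near side `{x₀ = 0}` free (the Dobrushin domain
`(R, c, d)` of the proof of DCHN's Lemma 15 / Duminil-Copin 2013, Lemma 10.7), `threeWired`,
with centre `(0, N)` of the free side (`threeBoxCentre`) and the box `centreBall N k` of radius `k`
about it. The two inputs are

* (hA) `φ_{T_N}(centre ↔ wired arc) ≤ C_A/√N` — the **half-plane one-arm bound** (DCHN Lemma 12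
  with Lemma 11 (i); Lemma 15 at `k = 0`), event `threeArm`;
* (hB) `φ_{T_N}(centreBall N k ↔ wired arc) ≤ C_B ((k+1)/N)^a` for **some** `a > 0` — the
  **strong half-plane one-arm bound** (DCHN Lemma 15, which gives `a = 1/2`), event `threeBallArm`.

Main results: `fkIsing_rsw_of_halfPlaneArmBounds (hA) (hB) : fkIsing_rsw`, and
`fkIsing_rsw_of_strongHalfPlaneArm`: `fkIsing_rsw` from the single DCHN-Lemma-15-shaped hypothesis
`φ_{T_N}(centreBall N k ↔ wired arc) ≤ C √((k+1)/N)` (all `N ≥ 1`, `k ≥ 0`).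

## The decoupling (`real_halfConn_inter_le_mul`, `real_halfConn_inter_le_rpow`)

For `a = (0, i)`, `b = (0, j)` on the free side with `ℓ = j - i ≥ 3`, put `r = ⌊(ℓ-1)/2⌋` and let
`Q_a`, `Q_b` be the local boxes of radius `r` (`locSites`: `v₀ ≤ r`, `|v₁ - i| ≤ r`), disjoint. If
`a ↔ side` and `b ↔ side` then (i) `a` is joined inside `Q_a` to the far layer of `Q_a` (follow the
path to its first visit of box level `r`, `halfConn_subset_locArmHalf`), (ii) likewise for `b`,
(iii) the union of the boxes is joined to the side by a path using no inside edge of the boxes (the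
path after its last visit, `halfConn_subset_ballConnOff`). Conditionally on the configuration off
`Q_a`, (i) has probability at most that of the box with its far layer wired
(`real_locArmHalf_inter_cylinder_le`: `rcMeasure_real_inter_cylinder_le_mul_fromEdgeSet` and the
identification `rcMeasure_fromEdgeSet_locEdges_eq`), which embeds into `T_r` (translation,
`real_locArm_le_threeArm` via the transport lemma `rcMeasure_real_openCrossing_le_shift`:
identification with idle vertices isolated, `rcMeasure_fromEdgeSet_real_le`, more wiring); then the
same for `Q_b`; the remaining event (iii) embeds into `T_{2n}` (`real_ballConnOff_le`). Hence
`φ(a, b ↔ side) ≤ (C_A/√r)² · C_B ((ℓ + r + 1)/(2n))^a ≤ 6 C_A² C_B ℓ^{a-1} n^{-a}`, and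
`Σ_{i,j} ≤ (10 + 24 C_A² C_B/a) n` (`sum_sum_pairProb_le`: near-diagonal terms by `1`, the others
telescoped through Bernoulli's inequality `a (m+1)^{a-1} ≤ (m+1)^a - m^a`). Any `a > 0` suffices:
the sharp exponent is only needed in (hA).

## References

* H. Duminil-Copin, C. Hongler, P. Nolin, *Connection probabilities and RSW-type bounds for the
  two-dimensional FK Ising model*, Comm. Pure Appl. Math. 64 (2011) 1165–1198 (arXiv:0912.4253),
  §4: Lemma 15, Props. 13–14, proof of Thm. 1. [DuminilCopinHonglerNolin2011]
* H. Duminil-Copin, S. Smirnov, *Conformal invariance of lattice models*, Clay Math. Proc. 15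
  (2012), Thm. 3.16, §6.1 (successive conditionings), §7.2. [DuminilCopinSmirnov2012Clay]
* G. Grimmett, *The Random-Cluster Model*, Springer (2006), Lemma (4.13), Lemma (4.14). [Grimmett2006]
-/

noncomputable section

namespace Literature.Probability.LatticeModels

open MeasureTheory Finset SimpleGraph
open Literature.Probability.Percolation


/-! ### Coordinates along lattice edges -/

/-- Adjacency of `ℤ²` is invariant under translation (this is `zdGraph_adj_add_left_iff` of
`LeftmostInterface.lean` up to `add_comm`; a local copy is kept because that file is not in the
import closure). [folklore] -/
theorem zdGraph_adj_add_iff (x y t : Site 2) : (zdGraph 2).Adj (x + t) (y + t) ↔ (zdGraph 2).Adj x y := by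
  rw [zdGraph_adj_iff, zdGraph_adj_iff]
  refine exists_congr fun i ↦ ?_
  constructor
  · rintro (h | h)
    · left; rw [add_right_comm] at h; exact add_right_cancel h
    · right; rw [add_right_comm] at h; exact add_right_cancel h
  · rintro (h | h)
    · left; rw [h, add_right_comm]
    · right; rw [h, add_right_comm]

/-! ### The three-sided wired box `T_N = [0, N] × [0, 2N]` -/

section ThreeBox

variable (N : ℕ)

/-- The wired arc of the three-sided box `T_N = [0, N] × [0, 2N]`: its far side `{x₀ = N}` and its
two lateral sides `{x₁ = 0}`, `{x₁ = 2N}` (the Dobrushin domain `(R, c, d)` of Duminil-Copin–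
Hongler–Nolin 2011, proof of Lemma 15 / Duminil-Copin 2013, Lemma 10.7: three wired sides, the
fourth side `{x₀ = 0}` free, transposed to H21's coordinates). [cite: DuminilCopinHonglerNolin2011, §4, Lemma 15] -/
def threeWired : Set ↥(rectangle N (2 * N)) :=
  {v | v.1 0 = N ∨ v.1 1 = 0 ∨ v.1 1 = 2 * N}

/-- Membership in `threeWired`. [folklore] -/
@[simp] theorem mem_threeWired {v : ↥(rectangle N (2 * N))} :
    v ∈ threeWired N ↔ v.1 0 = N ∨ v.1 1 = 0 ∨ v.1 1 = 2 * N := Iff.rfl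

/-- The centre `(0, N)` of the free side of `T_N`. [folklore] -/
def threeBoxCentre : ↥(rectangle N (2 * N)) :=
  ⟨![0, (N : ℤ)], by
    rw [mem_rectangle_iff]
    simp only [Matrix.cons_val_zero, Matrix.cons_val_one]
    refine ⟨le_rfl, ?_, ?_, ?_⟩
    · exact_mod_cast Nat.zero_le N
    · exact_mod_cast Nat.zero_le N
    · push_cast; linarith⟩

/-- The underlying site of the centre. [folklore] -/
@[simp] theorem threeBoxCentre_coe : (threeBoxCentre N : Site 2) = ![0, (N : ℤ)] := rfl

/-- The box of radius `k` about the centre of the free side: `{x₀ ≤ k, |x₁ - N| ≤ k}` (the ball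
`B_k(x)` of DCHN's Lemma 15, for the sup-distance). [cite: DuminilCopinHonglerNolin2011, §4, Lemma 15] -/
def centreBall (k : ℕ) : Set ↥(rectangle N (2 * N)) :=
  {v | v.1 0 ≤ k ∧ (N : ℤ) - k ≤ v.1 1 ∧ v.1 1 ≤ N + k}

/-- Membership in `centreBall`. [folklore] -/
@[simp] theorem mem_centreBall {k : ℕ} {v : ↥(rectangle N (2 * N))} :
    v ∈ centreBall N k ↔ v.1 0 ≤ k ∧ (N : ℤ) - k ≤ v.1 1 ∧ v.1 1 ≤ N + k := Iff.rfl

/-- **The half-plane one-arm event** of `T_N`: the centre of the free side is joined by an open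
path to the wired arc. [cite: DuminilCopinHonglerNolin2011, §4, Lemma 15] -/
def threeArm : Set (BondConfig ↥(rectangle N (2 * N))) :=
  openCrossing Set.univ {threeBoxCentre N} (threeWired N)

/-- **The strong half-plane one-arm event** of `T_N`: the box of radius `k` about the centre is
joined by an open path to the wired arc (`B_k(x) ↔ wired arc`). [cite: DuminilCopinHonglerNolin2011, §4, Lemma 15] -/
def threeBallArm (k : ℕ) : Set (BondConfig ↥(rectangle N (2 * N))) :=
  openCrossing Set.univ (centreBall N k) (threeWired N)

/-- The critical FK-Ising measure of `T_N` with its three sides wired, on the lattice graph.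
[cite: DuminilCopinHonglerNolin2011, §4, Lemma 15] -/
theorem fkIsingFiniteMeasure_threeBox_eq :
    fkIsingFiniteMeasure (rectangle N (2 * N)) (threeWired N) =
      rcMeasure (finsetGraph (zdGraph 2) (rectangle N (2 * N))) criticalFKIsingParam 2 (threeWired N) :=
  fkIsingFiniteMeasure_eq_finsetGraph _ _

end ThreeBox

/-! ### Transport of open crossings along a translation of finite lattice regions -/

section Transport

variable {S T : Finset (Site 2)} (t : Site 2) (hST : ∀ v ∈ S, v + t ∈ T)

/-- The translation `v ↦ v + t` from `S` into `T`. [folklore] -/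
def shiftEmb : ↥S ↪ ↥T :=
  ⟨fun v ↦ ⟨v.1 + t, hST v.1 v.2⟩, fun _ _ h ↦ Subtype.ext (add_right_cancel (congrArg Subtype.val h))⟩

/-- The underlying site of the translate. [folklore] -/
@[simp] theorem shiftEmb_coe (v : ↥S) : (shiftEmb t hST v : Site 2) = v.1 + t := rfl

/-- The translation preserves and reflects adjacency of the lattice graphs. [folklore] -/
theorem shiftEmb_adj_iff (v w : ↥S) :
    (finsetGraph (zdGraph 2) T).Adj (shiftEmb t hST v) (shiftEmb t hST w) ↔
      (finsetGraph (zdGraph 2) S).Adj v w := by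
  rw [finsetGraph_adj_iff, finsetGraph_adj_iff, shiftEmb_coe, shiftEmb_coe, zdGraph_adj_add_iff]

/-- The translated edges are edges of `T`. [folklore] -/
theorem map_edgeFinset_shiftEmb_subset :
    (finsetGraph (zdGraph 2) S).edgeFinset.map (shiftEmb t hST).sym2Map ⊆
      (finsetGraph (zdGraph 2) T).edgeFinset := by
  intro e he
  obtain ⟨e', he', rfl⟩ := Finset.mem_map.1 he
  induction e' using Sym2.ind with
  | h a b =>
    rw [mem_edgeFinset, mem_edgeSet] at he'
    rw [Function.Embedding.sym2Map_apply, Sym2.map_mk, mem_edgeFinset, mem_edgeSet]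
    exact (shiftEmb_adj_iff t hST a b).2 he'

/-- An open path of a configuration restricted along an injection pushes forward to an open path
of the configuration. [folklore] -/
theorem reachable_map_of_reachable_restrictConfig {V U : Type*} (j : V ↪ U) {ω : BondConfig U}
    {a b : V} (h : (openGraph (restrictConfig j ω)).Reachable a b) :
    (openGraph ω).Reachable (j a) (j b) := by
  obtain ⟨p⟩ := h
  induction p with
  | nil => exact Reachable.refl _
  | @cons x y z hxy p ih =>
    refine (Adj.reachable ?_).trans ih
    rw [openGraph_adj, mem_restrictConfig, Sym2.map_mk] at hxy
    rw [openGraph_adj]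
    exact ⟨hxy.1, fun h ↦ hxy.2 (j.injective h)⟩

/-- **Transport of open crossings along a translation** (domain monotonicity of the
random-cluster measure, Grimmett 2006, Lemma (4.13)/(4.14): a region sits inside a larger one with
fewer edges and less wiring). Let `v ↦ v + t` map `S` into `T` and the wired set `B` of `S` into
the wired set `B'` of `T`. Then for all vertex sets `In`, `Out` of `S`, the probability in `S`
(wired on `B`) of an open path from `In` to `Out` is at most the probability in `T` (wired on `B'`)
of an open path between their translates: identify `φ^B_S` with the spanning-graph measure of the
translated edges inside `T` with the idle vertices isolated
(`rcMeasure_real_restrictConfig_preimage_image`), dominate it by the ambient measure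
(`rcMeasure_fromEdgeSet_real_le`), enlarge the wiring (`rcMeasure_real_mono_wired_of_isUpperSet`),
and push the open path forward. [cite: Grimmett2006, Lemma (4.13) and Lemma (4.14)] -/
theorem rcMeasure_real_openCrossing_le_shift (B : Set ↥S) (B' : Set ↥T)
    (hBB' : ∀ v : ↥S, v ∈ B → shiftEmb t hST v ∈ B') (In Out : Set ↥S) :
    (rcMeasure (finsetGraph (zdGraph 2) S) criticalFKIsingParam 2 B).real
        (openCrossing Set.univ In Out) ≤
      (rcMeasure (finsetGraph (zdGraph 2) T) criticalFKIsingParam 2 B').real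
        (openCrossing Set.univ (shiftEmb t hST '' In) (shiftEmb t hST '' Out)) := by
  classical
  have hp : criticalFKIsingParam ∈ Set.Icc (0 : ℝ) 1 := criticalFKIsingParam_mem_Icc
  set j := shiftEmb t hST with hj
  set U : Finset (Sym2 ↥T) := (finsetGraph (zdGraph 2) S).edgeFinset.map j.sym2Map with hU
  have hUE : U ⊆ (finsetGraph (zdGraph 2) T).edgeFinset := map_edgeFinset_shiftEmb_subset t hST
  have hE : ∀ i : Fintype (fromEdgeSet (U : Set (Sym2 ↥T))).edgeSet,
      @SimpleGraph.edgeFinset _ (fromEdgeSet (U : Set (Sym2 ↥T))) i =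
        (finsetGraph (zdGraph 2) S).edgeFinset.map j.sym2Map := fun i ↦ by
    rw [@edgeFinset_fromEdgeSet_of_subset _ _ (finsetGraph (zdGraph 2) T) _ U hUE i]
  set E : Set (BondConfig ↥S) := openCrossing Set.univ In Out with hEdef
  have hEup : IsUpperSet E := isUpperSet_openCrossing _ _ _
  -- (a) identification with the spanning graph of the translated edges, idle vertices isolated
  have ha := rcMeasure_real_restrictConfig_preimage_image j (hE _) hp two_pos B E
  -- (b) domination by the ambient measure of `T`
  have hpre : IsUpperSet (restrictConfig j ⁻¹' E) := fun ω₁ ω₂ h h₁ ↦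
    hEup (fun e he ↦ h he) h₁
  have h0 : 0 < (rcMeasure (finsetGraph (zdGraph 2) T) criticalFKIsingParam 2 (j '' B)).real
      {ω | ω ∩ (↑U : Set (Sym2 ↥T))ᶜ = ∅} :=
    rcMeasure_real_allClosed_pos _ hp criticalFKIsingParam_mem_Ioo.2 two_pos _ _
  have hb := rcMeasure_fromEdgeSet_real_le (finsetGraph (zdGraph 2) T) hp one_le_two (j '' B) U hUE
    h0 hpre
  -- (c) more wiring
  have hup' : IsUpperSet {ω : BondConfig ↥T | ω ∩ ↑U ∈ restrictConfig j ⁻¹' E} := fun ω₁ ω₂ h h₁ ↦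
    hpre (Set.inter_subset_inter_left _ h) h₁
  have hc := rcMeasure_real_mono_wired_of_isUpperSet (finsetGraph (zdGraph 2) T) hp one_le_two
    (B := j '' B) (B' := B') (by rintro _ ⟨v, hv, rfl⟩; exact hBB' v hv) hup'
  -- (d) push the open path forward
  have hd : (rcMeasure (finsetGraph (zdGraph 2) T) criticalFKIsingParam 2 B').real
      {ω : BondConfig ↥T | ω ∩ ↑U ∈ restrictConfig j ⁻¹' E} ≤
      (rcMeasure (finsetGraph (zdGraph 2) T) criticalFKIsingParam 2 B').real
        (openCrossing Set.univ (j '' In) (j '' Out)) := by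
    refine rcMeasure_real_mono_on_edgeSets _ hp two_pos B' fun ω _ hω ↦ ?_
    rw [Set.mem_setOf_eq, Set.mem_preimage, hEdef, mem_openCrossing_univ_iff] at hω
    obtain ⟨x, hx, y, hy, hxy⟩ := hω
    rw [mem_openCrossing_univ_iff]
    refine ⟨j x, Set.mem_image_of_mem _ hx, j y, Set.mem_image_of_mem _ hy, ?_⟩
    have h1 := reachable_map_of_reachable_restrictConfig j hxy
    exact h1.mono (openGraph_mono Set.inter_subset_left)
  rw [← ha]
  exact hb.trans (hc.trans hd)

end Transport

/-- Open crossings are monotone in the two vertex sets. [folklore] -/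
theorem openCrossing_subset_openCrossing {V : Type*} {S A A' B B' : Set V} (hA : A ⊆ A') (hB : B ⊆ B') :
    openCrossing S A B ⊆ openCrossing S A' B' := by
  rintro ω ⟨x, hx, y, hy, hxy⟩
  exact ⟨x, hA hx, y, hB hy, hxy⟩

/-! ### The local box about a site of the free side of the half `H = [0, 2n] × [0, n]` -/

section LocalBox

variable (n : ℕ) (s : ℤ) (r : ℕ)

/-- The local box of radius `r` about the site `(0, s)` of the free side of the half
`H = [0, 2n] × [0, n]`: the sites `v` of `H` with `v₀ ≤ r` and `s - r ≤ v₁ ≤ s + r` (the box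
`B_r(x)` around a boundary point; DCHN 2011, §4). [cite: DuminilCopinHonglerNolin2011, §4, Lemma 15] -/
def locSites : Finset (Site 2) :=
  (rectangle (2 * n) n).filter fun v ↦ v 0 ≤ r ∧ s - r ≤ v 1 ∧ v 1 ≤ s + r

/-- Membership in the local box. [folklore] -/
theorem mem_locSites {v : Site 2} :
    v ∈ locSites n s r ↔ v ∈ rectangle (2 * n) n ∧ v 0 ≤ r ∧ s - r ≤ v 1 ∧ v 1 ≤ s + r := by
  rw [locSites, Finset.mem_filter]

/-- The local box lies in the half. [folklore] -/
theorem locSites_subset : locSites n s r ⊆ rectangle (2 * n) n := Finset.filter_subset _ _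

/-- The far layer of the local box: `{v₀ = r} ∪ {v₁ = s ± r}` (the part of its boundary inside the
half-plane; wired in the comparison domain). [cite: DuminilCopinHonglerNolin2011, §4, Lemma 15] -/
def farLayer : Set ↥(locSites n s r) := {v | v.1 0 = r ∨ v.1 1 = s - r ∨ v.1 1 = s + r}

/-- Membership in the far layer. [folklore] -/
@[simp] theorem mem_farLayer {v : ↥(locSites n s r)} :
    v ∈ farLayer n s r ↔ v.1 0 = r ∨ v.1 1 = s - r ∨ v.1 1 = s + r := Iff.rfl

/-- The local arm event of the box: the site `(0, s)` is joined inside the box by an open path to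
the far layer. [cite: DuminilCopinHonglerNolin2011, §4, Lemma 15] -/
def locArm : Set (BondConfig ↥(locSites n s r)) :=
  openCrossing Set.univ {v | v.1 = ![0, s]} (farLayer n s r)

/-- `locArm` is increasing. [folklore] -/
theorem isUpperSet_locArm : IsUpperSet (locArm n s r) := isUpperSet_openCrossing _ _ _

/-- The edges of the half inside the local box (the region `U` of the conditioning). [folklore] -/
abbrev locEdges : Finset (Sym2 ↥(rectangle (2 * n) n)) :=
  insideEdges (zdGraph 2) (locSites_subset n s r)

/-- The local arm event read in the half: the configuration inside the box has the local arm.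
[cite: DuminilCopinHonglerNolin2011, §4, Lemma 15] -/
def locArmHalf : Set (BondConfig ↥(rectangle (2 * n) n)) :=
  {ω | ω ∩ ↑(locEdges n s r) ∈ finsetRestrict (locSites_subset n s r) ⁻¹' locArm n s r}

/-- The wired set of the conditioning: every vertex, except the vertices of the box off its far
layer. [folklore] -/
def locWired : Set ↥(rectangle (2 * n) n) :=
  {v | v.1 ∈ locSites n s r → (v.1 0 = r ∨ v.1 1 = s - r ∨ v.1 1 = s + r)}

/-- Two adjacent vertices of the half inside the box span an inside edge. [folklore] -/
theorem mk_mem_locEdges {a b : ↥(rectangle (2 * n) n)}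
    (hab : (finsetGraph (zdGraph 2) (rectangle (2 * n) n)).Adj a b)
    (ha : a.1 ∈ locSites n s r) (hb : b.1 ∈ locSites n s r) : s(a, b) ∈ locEdges n s r := by
  have heq : s(a, b) = edgeLift (locSites_subset n s r) s(⟨a.1, ha⟩, ⟨b.1, hb⟩) := by
    rw [edgeLift_mk]; rfl
  rw [heq, edgeLift_mem_insideEdges_iff, mem_edgeFinset, mem_edgeSet, finsetGraph_adj_iff]
  exact hab

/-- The endpoints of an inside edge lie in the box. [folklore] -/
theorem mem_locSites_of_mem_locEdges {e : Sym2 ↥(rectangle (2 * n) n)} (he : e ∈ locEdges n s r)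
    {x : ↥(rectangle (2 * n) n)} (hx : x ∈ e) : x.1 ∈ locSites n s r := by
  obtain ⟨e', -, rfl⟩ := Finset.mem_map.1 he
  induction e' using Sym2.ind with
  | h a b =>
    rw [edgeLift_mk] at hx
    rcases Sym2.mem_iff.1 hx with rfl | rfl
    · exact a.2
    · exact b.2

/-- A vertex of the box adjacent to a vertex of the half outside the box lies on the far layer.
[folklore] -/
theorem far_of_adj_not_mem {a b : ↥(rectangle (2 * n) n)}
    (hab : (finsetGraph (zdGraph 2) (rectangle (2 * n) n)).Adj a b)
    (ha : a.1 ∈ locSites n s r) (hb : b.1 ∉ locSites n s r) :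
    a.1 0 = r ∨ a.1 1 = s - r ∨ a.1 1 = s + r := by
  rw [mem_locSites] at ha hb
  have hb' : ¬(b.1 0 ≤ r ∧ s - r ≤ b.1 1 ∧ b.1 1 ≤ s + r) := fun h ↦ hb ⟨b.2, h⟩
  have h0 := zdGraph_adj_apply_le ((finsetGraph_adj_iff a b).1 hab) 0
  have h1 := zdGraph_adj_apply_le ((finsetGraph_adj_iff a b).1 hab) 1
  have hbR' := mem_rectangle_iff.1 b.2
  obtain ⟨-, ha0, ha1, ha1'⟩ := ha
  omega

/-- Edges of the half off the box have both endpoints in the wired set. [folklore] -/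
theorem mem_locWired_of_mem_sdiff :
    ∀ e ∈ (finsetGraph (zdGraph 2) (rectangle (2 * n) n)).edgeFinset \ locEdges n s r,
      ∀ x ∈ e, x ∈ locWired n s r := by
  intro e he
  rw [Finset.mem_sdiff] at he
  obtain ⟨heE, heU⟩ := he
  induction e using Sym2.ind with
  | h a b =>
    rw [mem_edgeFinset, mem_edgeSet] at heE
    have hnot : ¬(a.1 ∈ locSites n s r ∧ b.1 ∈ locSites n s r) := fun h ↦
      heU (mk_mem_locEdges n s r heE h.1 h.2)
    intro x hx hxloc
    rcases Sym2.mem_iff.1 hx with rfl | rfl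
    · exact far_of_adj_not_mem n s r heE hxloc (fun h ↦ hnot ⟨hxloc, h⟩)
    · exact far_of_adj_not_mem n s r heE.symm hxloc (fun h ↦ hnot ⟨h, hxloc⟩)

/-- The wired side of the half is in the wired set of the conditioning (for `r < 2n`). [folklore] -/
theorem halfWiredSide_subset_locWired (hr : r < 2 * n) : halfWiredSide n ⊆ locWired n s r := by
  intro v hv hvloc
  rw [mem_halfWiredSide] at hv
  rw [mem_locSites] at hvloc
  omega

/-- The wired set of the conditioning is the far layer of the embedded box together with the idle
vertices. [folklore] -/
theorem mem_locWired_iff (u : ↥(rectangle (2 * n) n)) :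
    u ∈ locWired n s r ↔
      ∀ x : ↥(locSites n s r), finsetInclEmb (locSites_subset n s r) x = u → x ∈ farLayer n s r := by
  constructor
  · rintro hu x rfl
    exact hu x.2
  · intro h hu
    exact h ⟨u.1, hu⟩ (Subtype.ext rfl)

/-- The far layer is nonempty: it contains `(r, s)` (for `0 ≤ s ≤ n`, `r ≤ 2n`). [folklore] -/
theorem farLayer_nonempty (hs : 0 ≤ s ∧ s ≤ n) (hr : r ≤ 2 * n) : (farLayer n s r).Nonempty := by
  refine ⟨⟨![(r : ℤ), s], ?_⟩, Or.inl rfl⟩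
  rw [mem_locSites, mem_rectangle_iff]
  simp only [Matrix.cons_val_zero, Matrix.cons_val_one]
  omega

/-- **The conditional probability of the local arm is that of the box with its far layer wired**
(Grimmett 2006, Lemma (4.13): identification of the spanning-graph measure `⟨U⟩` wired on the far
layer and the idle vertices with the measure of the box). [cite: Grimmett2006, Lemma (4.13)] -/
theorem rcMeasure_fromEdgeSet_locEdges_eq (hs : 0 ≤ s ∧ s ≤ n) (hr : r ≤ 2 * n) :
    (rcMeasure (fromEdgeSet (↑(locEdges n s r) : Set (Sym2 ↥(rectangle (2 * n) n))))
        criticalFKIsingParam 2 (locWired n s r)).real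
        (finsetRestrict (locSites_subset n s r) ⁻¹' locArm n s r) =
      (rcMeasure (finsetGraph (zdGraph 2) (locSites n s r)) criticalFKIsingParam 2
        (farLayer n s r)).real (locArm n s r) := by
  classical
  have hE : ∀ i : Fintype (fromEdgeSet (↑(locEdges n s r) : Set (Sym2 ↥(rectangle (2 * n) n)))).edgeSet,
      @SimpleGraph.edgeFinset _ (fromEdgeSet (↑(locEdges n s r) : Set (Sym2 ↥(rectangle (2 * n) n)))) i =
        (finsetGraph (zdGraph 2) (locSites n s r)).edgeFinset.map
          (finsetInclEmb (locSites_subset n s r)).sym2Map := fun i ↦ by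
    rw [@edgeFinset_fromEdgeSet_of_subset _ _ (finsetGraph (zdGraph 2) (rectangle (2 * n) n)) _
      (locEdges n s r) (insideEdges_subset_edgeFinset _) i]
    rfl
  exact rcMeasure_real_restrictConfig_preimage_of_wired (finsetInclEmb (locSites_subset n s r))
    (hE _) criticalFKIsingParam_mem_Icc two_pos (farLayer_nonempty n s r hs hr)
    (mem_locWired_iff n s r) (locArm n s r)

/-- **The cylinder bound of the local arm** (Grimmett 2006, Lemma (4.14)(b) applied to the box):
conditionally on any configuration `ξ` off the box, the local arm has probability at most its
probability in the box with the far layer wired. [cite: Grimmett2006, Lemma (4.14)(b)] -/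
theorem real_locArmHalf_inter_cylinder_le (hs : 0 ≤ s ∧ s ≤ n) (hr : r < 2 * n)
    (ξ : Finset (Sym2 ↥(rectangle (2 * n) n)))
    (hξ : ξ ⊆ (finsetGraph (zdGraph 2) (rectangle (2 * n) n)).edgeFinset \ locEdges n s r) :
    (rcMeasure (finsetGraph (zdGraph 2) (rectangle (2 * n) n)) criticalFKIsingParam 2
        (halfWiredSide n)).real
        (locArmHalf n s r ∩ {ω | ω ∩ (↑(locEdges n s r) : Set (Sym2 ↥(rectangle (2 * n) n)))ᶜ = ↑ξ}) ≤
      (rcMeasure (finsetGraph (zdGraph 2) (locSites n s r)) criticalFKIsingParam 2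
          (farLayer n s r)).real (locArm n s r) *
        (rcMeasure (finsetGraph (zdGraph 2) (rectangle (2 * n) n)) criticalFKIsingParam 2
          (halfWiredSide n)).real
          {ω | ω ∩ (↑(locEdges n s r) : Set (Sym2 ↥(rectangle (2 * n) n)))ᶜ = ↑ξ} := by
  have hp : criticalFKIsingParam ∈ Set.Icc (0 : ℝ) 1 := criticalFKIsingParam_mem_Icc
  have hpre : IsUpperSet (finsetRestrict (locSites_subset n s r) ⁻¹' locArm n s r) :=
    fun ω₁ ω₂ h h₁ ↦ isUpperSet_locArm n s r (fun e he ↦ h he) h₁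
  have hξW : ∀ e ∈ (↑ξ : Set (Sym2 ↥(rectangle (2 * n) n))), ∀ x ∈ e, x ∈ locWired n s r :=
    fun e he x hx ↦ mem_locWired_of_mem_sdiff n s r e (hξ he) x hx
  have key := rcMeasure_real_inter_cylinder_le_mul_fromEdgeSet _ hp one_le_two (halfWiredSide n)
    (locEdges n s r) (insideEdges_subset_edgeFinset _) (↑ξ)
    (halfWiredSide_subset_locWired n s r hr) hξW hpre
  rw [rcMeasure_fromEdgeSet_locEdges_eq n s r hs hr.le] at key
  exact key.trans_eq (mul_comm _ _)

/-- **The local arm in the box is dominated by the one-arm event of the three-sided box `T_r`**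
(translate the box by `(0, r - s)` into `T_r`; its far layer goes to the wired arc, its centre to
the centre; fewer edges and less wiring in the box). [cite: Grimmett2006, Lemma (4.14)] -/
theorem real_locArm_le_threeArm :
    (rcMeasure (finsetGraph (zdGraph 2) (locSites n s r)) criticalFKIsingParam 2
        (farLayer n s r)).real (locArm n s r) ≤
      (rcMeasure (finsetGraph (zdGraph 2) (rectangle r (2 * r))) criticalFKIsingParam 2
        (threeWired r)).real (threeArm r) := by
  set t : Site 2 := ![0, (r : ℤ) - s] with ht
  have hST : ∀ v ∈ locSites n s r, v + t ∈ rectangle r (2 * r) := by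
    intro v hv
    rw [mem_locSites, mem_rectangle_iff] at hv
    rw [mem_rectangle_iff]
    simp only [ht, Pi.add_apply, Matrix.cons_val_zero, Matrix.cons_val_one]
    push_cast
    omega
  have hBB' : ∀ v : ↥(locSites n s r), v ∈ farLayer n s r → shiftEmb t hST v ∈ threeWired r := by
    intro v hv
    rw [mem_farLayer] at hv
    rw [mem_threeWired, shiftEmb_coe]
    simp only [ht, Pi.add_apply, Matrix.cons_val_zero, Matrix.cons_val_one]
    omega
  haveI := isProbabilityMeasure_rcMeasure (finsetGraph (zdGraph 2) (rectangle r (2 * r)))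
    criticalFKIsingParam_mem_Icc two_pos (threeWired r)
  refine (rcMeasure_real_openCrossing_le_shift t hST (farLayer n s r) (threeWired r) hBB'
    {v | v.1 = ![0, s]} (farLayer n s r)).trans ?_
  refine measureReal_mono (openCrossing_subset_openCrossing ?_ ?_) (measure_ne_top _ _)
  · rintro _ ⟨v, hv, rfl⟩
    rw [Set.mem_singleton_iff]
    refine Subtype.ext ?_
    rw [shiftEmb_coe, threeBoxCentre_coe]
    rw [Set.mem_setOf_eq] at hv
    rw [hv, ht]
    ext k
    fin_cases k <;> simp
  · rintro _ ⟨v, hv, rfl⟩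
    exact hBB' v hv

end LocalBox

/-! ### The box level and the inclusion `{a ↔ side} ⊆ {local arm at a}` -/

section Inclusions

variable (n : ℕ) (s : ℤ) (r : ℕ)

/-- The box level of a vertex of the half about `(0, s)`: `max (v₀, |v₁ - s|)`, written without
`abs`. [folklore] -/
def boxLevel (v : ↥(rectangle (2 * n) n)) : ℤ := max (v.1 0) (max (v.1 1 - s) (s - v.1 1))

/-- The sub-level sets of the box level are the local boxes. [folklore] -/
theorem boxLevel_le_iff (v : ↥(rectangle (2 * n) n)) :
    boxLevel n s v ≤ r ↔ v.1 ∈ locSites n s r := by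
  rw [mem_locSites, boxLevel, max_le_iff, max_le_iff]
  have hv := v.2
  constructor
  · rintro ⟨h0, h1, h2⟩; exact ⟨hv, h0, by omega, by omega⟩
  · rintro ⟨-, h0, h1, h2⟩; exact ⟨h0, by omega, by omega⟩

/-- The box level increases by at most one along an edge of the half. [folklore] -/
theorem boxLevel_le_add_one_of_adj {a b : ↥(rectangle (2 * n) n)}
    (hab : (finsetGraph (zdGraph 2) (rectangle (2 * n) n)).Adj a b) :
    boxLevel n s b ≤ boxLevel n s a + 1 := by
  have h0 := zdGraph_adj_apply_le ((finsetGraph_adj_iff a b).1 hab) 0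
  have h1 := zdGraph_adj_apply_le ((finsetGraph_adj_iff a b).1 hab) 1
  simp only [boxLevel, max_le_iff]
  refine ⟨?_, ?_, ?_⟩
  · have : a.1 0 ≤ max (a.1 0) (max (a.1 1 - s) (s - a.1 1)) := le_max_left _ _
    omega
  · have : a.1 1 - s ≤ max (a.1 0) (max (a.1 1 - s) (s - a.1 1)) :=
      (le_max_left _ _).trans (le_max_right _ _)
    omega
  · have : s - a.1 1 ≤ max (a.1 0) (max (a.1 1 - s) (s - a.1 1)) :=
      (le_max_right _ _).trans (le_max_right _ _)
    omega

/-- On the far layer the box level is `r`; conversely a vertex of the box at level `r` is on the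
far layer. [folklore] -/
theorem mem_farLayer_of_boxLevel_eq {v : ↥(rectangle (2 * n) n)} (hv : v.1 ∈ locSites n s r)
    (h : boxLevel n s v = r) : (⟨v.1, hv⟩ : ↥(locSites n s r)) ∈ farLayer n s r := by
  rw [mem_farLayer]
  rw [mem_locSites] at hv
  obtain ⟨-, h0, h1, h2⟩ := hv
  simp only [boxLevel] at h
  rcases le_total (v.1 0) (max (v.1 1 - s) (s - v.1 1)) with hle | hle
  · rw [max_eq_right hle] at h
    rcases le_total (v.1 1 - s) (s - v.1 1) with hle' | hle'
    · rw [max_eq_right hle'] at h; right; left; change v.1 1 = s - r; omega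
    · rw [max_eq_left hle'] at h; right; right; change v.1 1 = s + r; omega
  · rw [max_eq_left hle] at h; left; exact h

/-- **If `a = (0, s)` is joined to the wired side, the box about `a` has the local arm** (follow the
open path to its first visit to the far layer of the box; `r < 2n`, so the side is off the box).
[cite: DuminilCopinHonglerNolin2011, §4, proof of Prop. 14] -/
theorem halfConn_subset_locArmHalf {a : ↥(rectangle (2 * n) n)} (ha : a.1 = ![0, s]) (hr : r < 2 * n)
    {ω : BondConfig ↥(rectangle (2 * n) n)}
    (hωE : ω ⊆ (finsetGraph (zdGraph 2) (rectangle (2 * n) n)).edgeSet) (hω : ω ∈ halfConn n a) :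
    ω ∈ locArmHalf n s r := by
  classical
  rw [mem_halfConn_iff] at hω
  obtain ⟨z, hz, hreach⟩ := hω
  rw [mem_halfWiredSide] at hz
  have ha0 : a.1 0 = 0 := by rw [ha]; rfl
  have ha1 : a.1 1 = s := by rw [ha]; rfl
  -- the open graph is a subgraph of the lattice graph of the half
  have hadj : ∀ ⦃c d : ↥(rectangle (2 * n) n)⦄, (openGraph ω).Adj c d →
      (finsetGraph (zdGraph 2) (rectangle (2 * n) n)).Adj c d := by
    intro c d hcd
    rw [openGraph_adj] at hcd
    exact (mem_edgeSet _).1 (hωE hcd.1)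
  have hstep : ∀ ⦃c d : ↥(rectangle (2 * n) n)⦄, (openGraph ω).Adj c d →
      boxLevel n s d ≤ boxLevel n s c + 1 := fun c d hcd ↦ boxLevel_le_add_one_of_adj n s (hadj hcd)
  obtain ⟨p⟩ := hreach
  have hla : boxLevel n s a ≤ r := by
    simp only [boxLevel, max_le_iff]; omega
  have hlz : (r : ℤ) ≤ boxLevel n s z := by
    simp only [boxLevel]
    exact le_trans (by omega) (le_max_left _ _)
  obtain ⟨z', hz', hreach'⟩ := exists_level_reachable (boxLevel n s) r hstep p hla hlz
  -- pull back to the box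
  set ι := finsetInclEmb (locSites_subset n s r) with hι
  have hrange : ∀ v : ↥(rectangle (2 * n) n), (∃ x, ι x = v) ↔ boxLevel n s v ≤ r := by
    intro v
    rw [boxLevel_le_iff]
    constructor
    · rintro ⟨x, rfl⟩; exact x.2
    · intro hv; exact ⟨⟨v.1, hv⟩, Subtype.ext rfl⟩
  have haloc : a.1 ∈ locSites n s r := (boxLevel_le_iff n s r a).1 hla
  have haι : ι ⟨a.1, haloc⟩ = a := Subtype.ext rfl
  rw [← haι] at hreach'
  obtain ⟨z'', hz'', hreach''⟩ :=
    exists_reachable_restrictConfig_of_reachable_below ι (boxLevel n s) r hrange hstep hreach'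
  have hz''loc : z'.1 ∈ locSites n s r := by rw [← hz'']; exact z''.2
  have hfar : z'' ∈ farLayer n s r := by
    have h := mem_farLayer_of_boxLevel_eq n s r hz''loc hz'
    have hval : (z'' : Site 2) = z'.1 := congrArg Subtype.val hz''
    have : z'' = ⟨z'.1, hz''loc⟩ := Subtype.ext hval
    rw [this]; exact h
  -- the arm of the restricted configuration
  change restrictConfig (finsetIncl (locSites_subset n s r)) (ω ∩ ↑(locEdges n s r)) ∈ locArm n s r
  rw [locArm, mem_openCrossing_univ_iff]
  refine ⟨⟨a.1, haloc⟩, ha, z'', hfar, hreach''.mono ?_⟩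
  intro c d hcd
  rw [openGraph_adj, mem_restrictConfig, Sym2.map_mk] at hcd ⊢
  refine ⟨⟨hcd.1, ?_⟩, hcd.2⟩
  have hadj' : (finsetGraph (zdGraph 2) (rectangle (2 * n) n)).Adj (ι c) (ι d) :=
    (mem_edgeSet _).1 (hωE hcd.1)
  exact mk_mem_locEdges n s r hadj' c.2 d.2

/-- The inside edges of two separated local boxes are disjoint. [folklore] -/
theorem disjoint_locEdges {s s' : ℤ} (h : s + r < s' - r) :
    Disjoint (locEdges n s r) (locEdges n s' r) := by
  rw [Finset.disjoint_left]
  intro e he he'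
  induction e using Sym2.ind with
  | h a b =>
    have h1 := mem_locSites_of_mem_locEdges n s r he (Sym2.mem_mk_left a b)
    have h2 := mem_locSites_of_mem_locEdges n s' r he' (Sym2.mem_mk_left a b)
    rw [mem_locSites] at h1 h2
    omega

end Inclusions

/-! ### The ball event: the two boxes are joined to the wired side off their inside edges -/

section Ball

variable (n : ℕ) (s s' : ℤ) (r : ℕ)

/-- The union of the two local boxes, as a set of vertices of the half. [folklore] -/
def pairBall : Set ↥(rectangle (2 * n) n) := {v | v.1 ∈ locSites n s r ∨ v.1 ∈ locSites n s' r}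

/-- **The ball event**: the union of the two boxes is joined to the wired side by an open path
using no inside edge of either box (`B_k ↔ wired arc` off the local regions; the third event of
the decoupling). [cite: DuminilCopinHonglerNolin2011, §4, Lemma 15] -/
def ballConnOff : Set (BondConfig ↥(rectangle (2 * n) n)) :=
  {ω | ω ∩ (↑(locEdges n s r ∪ locEdges n s' r) : Set (Sym2 ↥(rectangle (2 * n) n)))ᶜ ∈
    openCrossing Set.univ (pairBall n s s' r) (halfWiredSide n)}

/-- **First entrance into a set along a walk**: a walk ending in `P` reaches a vertex of `P` through
edges each having an endpoint outside `P`. [folklore] -/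
theorem exists_mem_reachable_inf_fromRel {W : Type*} {K : SimpleGraph W} (P : Set W) {u x : W}
    (p : K.Walk u x) (hx : x ∈ P) : ∃ v ∈ P, (K ⊓ fromRel fun a _ ↦ a ∉ P).Reachable u v := by
  induction p with
  | nil => exact ⟨_, hx, Reachable.refl _⟩
  | @cons a b c hab p ih =>
    by_cases ha : a ∈ P
    · exact ⟨a, ha, Reachable.refl _⟩
    · obtain ⟨v, hv, hreach⟩ := ih hx
      refine ⟨v, hv, (Adj.reachable ?_).trans hreach⟩
      rw [inf_adj, fromRel_adj]
      exact ⟨hab, hab.ne, Or.inl ha⟩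

/-- **If a vertex of one of the boxes is joined to the wired side, the ball event holds** (the part
of the open path after its last visit to the two boxes). [cite: DuminilCopinHonglerNolin2011, §4, proof of Prop. 14] -/
theorem halfConn_subset_ballConnOff {a : ↥(rectangle (2 * n) n)} (ha : a ∈ pairBall n s s' r)
    {ω : BondConfig ↥(rectangle (2 * n) n)} (hω : ω ∈ halfConn n a) :
    ω ∈ ballConnOff n s s' r := by
  classical
  rw [mem_halfConn_iff] at hω
  obtain ⟨z, hz, hreach⟩ := hω
  obtain ⟨p⟩ := hreach.symm
  obtain ⟨v, hv, hreach'⟩ := exists_mem_reachable_inf_fromRel (pairBall n s s' r) p ha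
  change ω ∩ (↑(locEdges n s r ∪ locEdges n s' r) : Set (Sym2 ↥(rectangle (2 * n) n)))ᶜ ∈
    openCrossing Set.univ (pairBall n s s' r) (halfWiredSide n)
  rw [mem_openCrossing_univ_iff]
  refine ⟨v, hv, z, hz, (hreach'.mono ?_).symm⟩
  intro c d hcd
  rw [inf_adj, fromRel_adj, openGraph_adj] at hcd
  obtain ⟨⟨hmem, hne⟩, -, hout⟩ := hcd
  rw [openGraph_adj]
  refine ⟨⟨hmem, ?_⟩, hne⟩
  rw [Set.mem_compl_iff, Finset.mem_coe, Finset.mem_union, not_or]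
  constructor
  · intro he
    rcases hout with hc | hd
    · exact hc (Or.inl (mem_locSites_of_mem_locEdges n s r he (Sym2.mem_mk_left c d)))
    · exact hd (Or.inl (mem_locSites_of_mem_locEdges n s r he (Sym2.mem_mk_right c d)))
  · intro he
    rcases hout with hc | hd
    · exact hc (Or.inr (mem_locSites_of_mem_locEdges n s' r he (Sym2.mem_mk_left c d)))
    · exact hd (Or.inr (mem_locSites_of_mem_locEdges n s' r he (Sym2.mem_mk_right c d)))

/-- **The ball event is dominated by the strong one-arm event of `T_{2n}`** (translate the half by
`(0, 2n - s')` into `T_{2n} = [0, 2n] × [0, 4n]`; the wired side goes to the wired arc, the two boxes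
into the box of radius `d + r` about the centre, `|s - s'| ≤ d`). [cite: Grimmett2006, Lemma (4.14)] -/
theorem real_ballConnOff_le (hs' : 0 ≤ s' ∧ s' ≤ n) {d : ℕ}
    (hd : s' - s ≤ d ∧ s - s' ≤ d) :
    (rcMeasure (finsetGraph (zdGraph 2) (rectangle (2 * n) n)) criticalFKIsingParam 2
        (halfWiredSide n)).real (ballConnOff n s s' r) ≤
      (rcMeasure (finsetGraph (zdGraph 2) (rectangle (2 * n) (2 * (2 * n)))) criticalFKIsingParam 2
        (threeWired (2 * n))).real (threeBallArm (2 * n) (d + r)) := by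
  have hp : criticalFKIsingParam ∈ Set.Icc (0 : ℝ) 1 := criticalFKIsingParam_mem_Icc
  -- drop the restriction to the edges off the boxes
  have h1 : (rcMeasure (finsetGraph (zdGraph 2) (rectangle (2 * n) n)) criticalFKIsingParam 2
      (halfWiredSide n)).real (ballConnOff n s s' r) ≤
      (rcMeasure (finsetGraph (zdGraph 2) (rectangle (2 * n) n)) criticalFKIsingParam 2
        (halfWiredSide n)).real (openCrossing Set.univ (pairBall n s s' r) (halfWiredSide n)) :=
    rcMeasure_real_mono_on_edgeSets _ hp two_pos _ fun ω _ hω ↦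
      isUpperSet_openCrossing _ _ _ Set.inter_subset_left hω
  refine h1.trans ?_
  -- translate
  set t : Site 2 := ![0, (2 * n : ℤ) - s'] with ht
  have hST : ∀ v ∈ rectangle (2 * n) n, v + t ∈ rectangle (2 * n) (2 * (2 * n)) := by
    intro v hv
    rw [mem_rectangle_iff] at hv ⊢
    simp only [ht, Pi.add_apply, Matrix.cons_val_zero, Matrix.cons_val_one]
    push_cast
    omega
  have hBB' : ∀ v : ↥(rectangle (2 * n) n), v ∈ halfWiredSide n →
      shiftEmb t hST v ∈ threeWired (2 * n) := by
    intro v hv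
    rw [mem_halfWiredSide] at hv
    rw [mem_threeWired, shiftEmb_coe]
    left
    simp only [ht, Pi.add_apply, Matrix.cons_val_zero]
    push_cast
    omega
  haveI := isProbabilityMeasure_rcMeasure (finsetGraph (zdGraph 2) (rectangle (2 * n) (2 * (2 * n))))
    hp two_pos (threeWired (2 * n))
  refine (rcMeasure_real_openCrossing_le_shift t hST (halfWiredSide n) (threeWired (2 * n)) hBB'
    (pairBall n s s' r) (halfWiredSide n)).trans ?_
  refine measureReal_mono (openCrossing_subset_openCrossing ?_ ?_) (measure_ne_top _ _)
  · rintro _ ⟨v, hv, rfl⟩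
    rw [mem_centreBall, shiftEmb_coe]
    simp only [ht, Pi.add_apply, Matrix.cons_val_zero, Matrix.cons_val_one]
    change v.1 ∈ locSites n s r ∨ v.1 ∈ locSites n s' r at hv
    rw [mem_locSites, mem_locSites, mem_rectangle_iff] at hv
    push_cast
    omega
  · rintro _ ⟨v, hv, rfl⟩
    exact hBB' v hv

end Ball

/-! ### The decoupling: two local arms and the ball event -/

section Decoupling

variable (n : ℕ) (r : ℕ)

/-- Events read off a part of the configuration outside `U` are determined off `U`. [folklore] -/
theorem inter_eq_inter_of_subset_compl {E : Type*} {U S : Set E} (hS : S ⊆ Uᶜ) {ω₁ ω₂ : Set E}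
    (h : ω₁ ∩ Uᶜ = ω₂ ∩ Uᶜ) : ω₁ ∩ S = ω₂ ∩ S := by
  have h1 : ω₁ ∩ S = (ω₁ ∩ Uᶜ) ∩ S := by
    rw [Set.inter_assoc, Set.inter_eq_right.2 hS]
  have h2 : ω₂ ∩ S = (ω₂ ∩ Uᶜ) ∩ S := by
    rw [Set.inter_assoc, Set.inter_eq_right.2 hS]
  rw [h1, h2, h]

/-- The local arm probability of the box of radius `r` about `(0, s)` with its far layer wired (the
constant of the cylinder bound). [cite: DuminilCopinHonglerNolin2011, §4, Lemma 15] -/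
def locArmProb (s : ℤ) : ℝ :=
  (rcMeasure (finsetGraph (zdGraph 2) (locSites n s r)) criticalFKIsingParam 2 (farLayer n s r)).real
    (locArm n s r)

/-- `locArmProb` is nonnegative. [folklore] -/
theorem locArmProb_nonneg (s : ℤ) : 0 ≤ locArmProb n r s := measureReal_nonneg

/-- **The decoupling inequality** (replacing DCHN's exploration argument for Prop. 14 by two
successive conditionings, Duminil-Copin–Smirnov 2012, §6.1 / Grimmett 2006, Lemma (4.14)(b)). For
the sites `a = (0, s)`, `b = (0, s')` of the free side of the half `H = [0, 2n] × [0, n]` and a radius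
`r` with `s + r < s' - r` (the two local boxes are disjoint):
`φ^{side}_H(a ↔ side, b ↔ side) ≤ θ(s) · θ(s') · φ^{side}_H(ball event)`, where `θ(x)` is the
probability of the local arm in the box about `x` with its far layer wired: both open paths produce
a local arm in their box and, after their last visit to the boxes, the ball event
(`halfConn_subset_locArmHalf`, `halfConn_subset_ballConnOff`); condition successively on the
configuration off each box (`rcMeasure_real_inter_le_mul_of_cylinder_le` with the cylinder bound
`real_locArmHalf_inter_cylinder_le`). [cite: DuminilCopinSmirnov2012Clay, §6.1; Grimmett2006, Lemma (4.14)(b)] -/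
theorem real_halfConn_inter_le_mul {s s' : ℤ} {a b : ↥(rectangle (2 * n) n)} (ha : a.1 = ![0, s])
    (hb : b.1 = ![0, s']) (hsep : s + r < s' - r) :
    (rcMeasure (finsetGraph (zdGraph 2) (rectangle (2 * n) n)) criticalFKIsingParam 2
        (halfWiredSide n)).real (halfConn n a ∩ halfConn n b) ≤
      locArmProb n r s * (locArmProb n r s' *
        (rcMeasure (finsetGraph (zdGraph 2) (rectangle (2 * n) n)) criticalFKIsingParam 2
          (halfWiredSide n)).real (ballConnOff n s s' r)) := by
  classical
  have hp : criticalFKIsingParam ∈ Set.Icc (0 : ℝ) 1 := criticalFKIsingParam_mem_Icc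
  set μ := rcMeasure (finsetGraph (zdGraph 2) (rectangle (2 * n) n)) criticalFKIsingParam 2
    (halfWiredSide n) with hμ
  -- the coordinates of `a` and `b`
  have haR := mem_rectangle_iff.1 a.2
  have hbR := mem_rectangle_iff.1 b.2
  rw [ha] at haR
  rw [hb] at hbR
  simp only [Matrix.cons_val_zero, Matrix.cons_val_one] at haR hbR
  have hs : 0 ≤ s ∧ s ≤ n := ⟨haR.2.2.1, haR.2.2.2⟩
  have hs' : 0 ≤ s' ∧ s' ≤ n := ⟨hbR.2.2.1, hbR.2.2.2⟩
  have hr : r < 2 * n := by omega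
  have haball : a ∈ pairBall n s s' r := by
    left
    rw [mem_locSites, ha, mem_rectangle_iff]
    simp only [Matrix.cons_val_zero, Matrix.cons_val_one]
    omega
  -- the three events
  set U := locEdges n s r with hU
  set U' := locEdges n s' r with hU'
  have hdisj : Disjoint U U' := disjoint_locEdges n r hsep
  have hU'c : (↑U' : Set (Sym2 ↥(rectangle (2 * n) n))) ⊆ (↑U)ᶜ := by
    intro e he heU
    exact Finset.disjoint_left.1 hdisj heU he
  have hUc : (↑U : Set (Sym2 ↥(rectangle (2 * n) n))) ⊆ (↑U')ᶜ := by
    intro e he heU'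
    exact Finset.disjoint_left.1 hdisj he heU'
  have hUUc : (↑(U ∪ U') : Set (Sym2 ↥(rectangle (2 * n) n)))ᶜ ⊆ (↑U)ᶜ := by
    rw [Finset.coe_union]; exact Set.compl_subset_compl.2 Set.subset_union_left
  have hUUc' : (↑(U ∪ U') : Set (Sym2 ↥(rectangle (2 * n) n)))ᶜ ⊆ (↑U')ᶜ := by
    rw [Finset.coe_union]; exact Set.compl_subset_compl.2 Set.subset_union_right
  -- step 0: inclusion of events (on lattice configurations)
  have h0 : μ.real (halfConn n a ∩ halfConn n b) ≤
      μ.real (locArmHalf n s r ∩ (locArmHalf n s' r ∩ ballConnOff n s s' r)) := by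
    refine rcMeasure_real_mono_on_edgeSets _ hp two_pos _ fun ω hωE hω ↦ ?_
    exact ⟨halfConn_subset_locArmHalf n s r ha hr hωE hω.1,
      halfConn_subset_locArmHalf n s' r hb hr hωE hω.2,
      halfConn_subset_ballConnOff n s s' r haball hω.1⟩
  -- step 1: condition on the configuration off the box about `a`
  have hF1 : ∀ ω₁ ω₂ : BondConfig ↥(rectangle (2 * n) n), ω₁ ∩ (↑U)ᶜ = ω₂ ∩ (↑U)ᶜ →
      (ω₁ ∈ locArmHalf n s' r ∩ ballConnOff n s s' r ↔ ω₂ ∈ locArmHalf n s' r ∩ ballConnOff n s s' r) := by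
    intro ω₁ ω₂ h
    have h1 : ω₁ ∩ ↑U' = ω₂ ∩ ↑U' := inter_eq_inter_of_subset_compl hU'c h
    have h2 := inter_eq_inter_of_subset_compl hUUc h
    simp only [Set.mem_inter_iff, locArmHalf, ballConnOff, Set.mem_setOf_eq, Set.mem_preimage]
    rw [h1, h2]
  have h1 : μ.real (locArmHalf n s r ∩ (locArmHalf n s' r ∩ ballConnOff n s s' r)) ≤
      locArmProb n r s * μ.real (locArmHalf n s' r ∩ ballConnOff n s s' r) :=
    rcMeasure_real_inter_le_mul_of_cylinder_le _ hp two_pos (halfWiredSide n) U hF1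
      (fun ξ hξ ↦ real_locArmHalf_inter_cylinder_le n s r hs hr ξ hξ)
  -- step 2: condition on the configuration off the box about `b`
  have hF2 : ∀ ω₁ ω₂ : BondConfig ↥(rectangle (2 * n) n), ω₁ ∩ (↑U')ᶜ = ω₂ ∩ (↑U')ᶜ →
      (ω₁ ∈ ballConnOff n s s' r ↔ ω₂ ∈ ballConnOff n s s' r) := by
    intro ω₁ ω₂ h
    have h2 := inter_eq_inter_of_subset_compl hUUc' h
    simp only [ballConnOff, Set.mem_setOf_eq]
    rw [h2]
  have h2 : μ.real (locArmHalf n s' r ∩ ballConnOff n s s' r) ≤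
      locArmProb n r s' * μ.real (ballConnOff n s s' r) :=
    rcMeasure_real_inter_le_mul_of_cylinder_le _ hp two_pos (halfWiredSide n) U' hF2
      (fun ξ hξ ↦ real_locArmHalf_inter_cylinder_le n s' r hs' hr ξ hξ)
  calc μ.real (halfConn n a ∩ halfConn n b)
      ≤ μ.real (locArmHalf n s r ∩ (locArmHalf n s' r ∩ ballConnOff n s s' r)) := h0
    _ ≤ locArmProb n r s * μ.real (locArmHalf n s' r ∩ ballConnOff n s s' r) := h1
    _ ≤ locArmProb n r s * (locArmProb n r s' * μ.real (ballConnOff n s s' r)) :=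
        mul_le_mul_of_nonneg_left h2 (locArmProb_nonneg n r s)

end Decoupling

/-! ### Arithmetic: a telescoping bound for `Σ ℓ^{a-1}` -/

section Arithmetic

/-- **Bernoulli**: `a (m+1)^{a-1} ≤ (m+1)^a - m^a` for `0 < a ≤ 1`, `m ≥ 0` (concavity of `t ↦ t^a`).
[folklore] -/
theorem mul_rpow_sub_one_le_sub {a : ℝ} (ha0 : 0 < a) (ha1 : a ≤ 1) {m : ℝ} (hm : 0 ≤ m) :
    a * (m + 1) ^ (a - 1) ≤ (m + 1) ^ a - m ^ a := by
  have hm1 : 0 < m + 1 := by linarith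
  have hs : (-1 : ℝ) ≤ -(1 / (m + 1)) := by
    rw [neg_le_neg_iff, div_le_one hm1]; linarith
  have hB := rpow_one_add_le_one_add_mul_self hs ha0.le ha1
  -- `(1 - 1/(m+1))^a = m^a / (m+1)^a`
  have heq : (1 + -(1 / (m + 1))) = m / (m + 1) := by field_simp; ring
  rw [heq, Real.div_rpow hm hm1.le] at hB
  have hpow : 0 < (m + 1) ^ a := Real.rpow_pos_of_pos hm1 a
  have h1 : m ^ a ≤ (m + 1) ^ a * (1 + a * -(1 / (m + 1))) := by
    rw [div_le_iff₀ hpow] at hB; linarith [hB]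
  have h2 : (m + 1) ^ a * (1 + a * -(1 / (m + 1))) = (m + 1) ^ a - a * (m + 1) ^ (a - 1) := by
    rw [Real.rpow_sub_one hm1.ne']
    field_simp
    ring
  linarith [h1, h2]

/-- **`Σ_{m < M} (m+1)^{a-1} ≤ M^a / a`** for `0 < a ≤ 1` (telescoping the Bernoulli bound).
[folklore] -/
theorem sum_range_rpow_sub_one_le {a : ℝ} (ha0 : 0 < a) (ha1 : a ≤ 1) (M : ℕ) :
    ∑ m ∈ Finset.range M, ((m : ℝ) + 1) ^ (a - 1) ≤ (M : ℝ) ^ a / a := by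
  have hterm : ∀ m ∈ Finset.range M,
      ((m : ℝ) + 1) ^ (a - 1) ≤ (((m + 1 : ℕ) : ℝ) ^ a - ((m : ℕ) : ℝ) ^ a) / a := by
    intro m _
    rw [le_div_iff₀ ha0, mul_comm]
    push_cast
    exact mul_rpow_sub_one_le_sub ha0 ha1 (Nat.cast_nonneg m)
  refine (Finset.sum_le_sum hterm).trans ?_
  rw [← Finset.sum_div, Finset.sum_range_sub (fun m ↦ ((m : ℕ) : ℝ) ^ a) M]
  simp [Real.zero_rpow ha0.ne']

/-- At most five integers `j` satisfy `|i - j| ≤ 2`. [folklore] -/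
theorem card_filter_near_le (i M : ℕ) :
    ((Finset.range M).filter fun j ↦ i ≤ j + 2 ∧ j ≤ i + 2).card ≤ 5 := by
  calc ((Finset.range M).filter fun j ↦ i ≤ j + 2 ∧ j ≤ i + 2).card
      ≤ (Finset.Icc (i - 2) (i + 2)).card := by
        refine Finset.card_le_card fun j hj ↦ ?_
        rw [Finset.mem_filter] at hj
        rw [Finset.mem_Icc]
        omega
    _ ≤ 5 := by rw [Nat.card_Icc]; omega

end Arithmetic

/-! ### The two-point bound and its sum -/

section TwoPoint

variable {C_A C_B a : ℝ}

/-- Real arithmetic of the two-point bound: `(C_A²/r) · C_B (ℓ/n)^a ≤ 6 C_A² C_B ℓ^{a-1} n^{-a}` when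
`ℓ ≤ 6r`. [folklore] -/
theorem twoPoint_arith (hCB : 0 ≤ C_B) {ℓ r n : ℝ} (hr0 : 0 < r) (hℓ0 : 0 < ℓ)
    (hn0 : 0 < n) (h6 : ℓ ≤ 6 * r) (a : ℝ) :
    C_A ^ 2 / r * (C_B * (ℓ / n) ^ a) ≤ 6 * C_A ^ 2 * C_B * ℓ ^ (a - 1) * n ^ (-a) := by
  rw [Real.div_rpow hℓ0.le hn0.le, Real.rpow_neg hn0.le, Real.rpow_sub_one hℓ0.ne']
  have hr6 : 1 / r ≤ 6 / ℓ := by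
    rw [div_le_div_iff₀ hr0 hℓ0]; linarith
  have hpos : 0 ≤ C_A ^ 2 * C_B * ℓ ^ a * (n ^ a)⁻¹ := by positivity
  calc C_A ^ 2 / r * (C_B * (ℓ ^ a / n ^ a))
      = (1 / r) * (C_A ^ 2 * C_B * ℓ ^ a * (n ^ a)⁻¹) := by ring
    _ ≤ (6 / ℓ) * (C_A ^ 2 * C_B * ℓ ^ a * (n ^ a)⁻¹) := mul_le_mul_of_nonneg_right hr6 hpos
    _ = 6 * C_A ^ 2 * C_B * (ℓ ^ a / ℓ) * (n ^ a)⁻¹ := by field_simp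

/-- Real arithmetic of the ball bound: `(ℓ + r + 1)/(2n) ≤ ℓ/n` when `ℓ + r + 1 ≤ 2ℓ`. [folklore] -/
theorem ball_arith {ℓ r n : ℝ} (hn0 : 0 < n) (h : ℓ + r + 1 ≤ 2 * ℓ) :
    (ℓ + r + 1) / (2 * n) ≤ ℓ / n := by
  rw [div_le_div_iff₀ (by positivity) hn0]
  have := mul_le_mul_of_nonneg_right h hn0.le
  linarith

/-- **The two-point bound from the arm bounds.** If the one-arm probability of `T_N` is at most
`C_A/√N` and the strong one-arm probability of radius `k` is at most `C_B ((k+1)/N)^a` (`a > 0`),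
then for the sites `(0, i)`, `(0, j)` of the free side of the half with `j ≥ i + 3`,
`φ^{side}_H((0,i) ↔ side, (0,j) ↔ side) ≤ 6 C_A² C_B (j - i)^{a-1} n^{-a}`: the decoupling
inequality with radius `r = ⌊(j-i-1)/2⌋`, the local arms bounded through `T_r` and the ball event
through `T_{2n}`. [cite: DuminilCopinHonglerNolin2011, §4, Prop. 14 and Lemma 15] -/
theorem real_halfConn_inter_le_rpow (hCB : 0 ≤ C_B) (ha0 : 0 < a)
    (hA : ∀ N : ℕ, 1 ≤ N →
      (rcMeasure (finsetGraph (zdGraph 2) (rectangle N (2 * N))) criticalFKIsingParam 2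
        (threeWired N)).real (threeArm N) ≤ C_A / Real.sqrt N)
    (hB : ∀ N : ℕ, 1 ≤ N → ∀ k : ℕ,
      (rcMeasure (finsetGraph (zdGraph 2) (rectangle N (2 * N))) criticalFKIsingParam 2
        (threeWired N)).real (threeBallArm N k) ≤ C_B * (((k : ℝ) + 1) / N) ^ a)
    {n : ℕ} (hn : 1 ≤ n) {i j : ℕ} (hj : j ≤ n) (hij : i + 3 ≤ j) :
    (rcMeasure (finsetGraph (zdGraph 2) (rectangle (2 * n) n)) criticalFKIsingParam 2
        (halfWiredSide n)).real (halfConn n (sideSite n i) ∩ halfConn n (sideSite n j)) ≤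
      6 * C_A ^ 2 * C_B * ((j - i : ℕ) : ℝ) ^ (a - 1) * (n : ℝ) ^ (-a) := by
  -- the distance and the radius, as opaque naturals
  obtain ⟨ℓ, hℓ⟩ : ∃ ℓ : ℕ, j - i = ℓ := ⟨_, rfl⟩
  obtain ⟨r, hr⟩ : ∃ r : ℕ, (ℓ - 1) / 2 = r := ⟨_, rfl⟩
  rw [hℓ]
  have hℓ3 : 3 ≤ ℓ := by omega
  have hr1 : 1 ≤ r := by omega
  have h2r : 2 * r + 1 ≤ ℓ := by omega
  have h6r : ℓ ≤ 6 * r := by omega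
  have hi : i ≤ n := by omega
  have hn0 : (0 : ℝ) < n := by exact_mod_cast hn
  have hℓ0 : (0 : ℝ) < ℓ := by exact_mod_cast (by omega : 0 < ℓ)
  have hr0 : (0 : ℝ) < r := by exact_mod_cast hr1
  have h6r' : (ℓ : ℝ) ≤ 6 * r := by exact_mod_cast h6r
  have h2ℓ : (ℓ : ℝ) + r + 1 ≤ 2 * ℓ := by exact_mod_cast (by omega : ℓ + r + 1 ≤ 2 * ℓ)
  -- the decoupling
  have hsep : (i : ℤ) + r < (j : ℤ) - r := by omega
  have hdec := real_halfConn_inter_le_mul n r (s := i) (s' := j) (a := sideSite n i)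
    (b := sideSite n j) (sideSite_coe_of_le n hi) (sideSite_coe_of_le n hj) hsep
  -- the local arms
  have hθ : ∀ x : ℤ, locArmProb n r x ≤ C_A / Real.sqrt r := fun x ↦
    (real_locArm_le_threeArm n x r).trans (hA r hr1)
  have hθ0 : ∀ x : ℤ, 0 ≤ locArmProb n r x := fun x ↦ locArmProb_nonneg n r x
  have hθθ : locArmProb n r i * locArmProb n r j ≤ C_A ^ 2 / r := by
    calc locArmProb n r i * locArmProb n r j
        ≤ (C_A / Real.sqrt r) * (C_A / Real.sqrt r) :=
          mul_le_mul (hθ i) (hθ j) (hθ0 j) ((hθ0 i).trans (hθ i))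
      _ = C_A ^ 2 / r := by
          rw [div_mul_div_comm, ← sq, Real.mul_self_sqrt hr0.le]
  -- the ball event
  have hjj : (0 : ℤ) ≤ (j : ℤ) ∧ (j : ℤ) ≤ (n : ℤ) := ⟨by exact_mod_cast Nat.zero_le j, by exact_mod_cast hj⟩
  have hdd : (j : ℤ) - (i : ℤ) ≤ (ℓ : ℤ) ∧ (i : ℤ) - (j : ℤ) ≤ (ℓ : ℤ) := by omega
  have hball1 := real_ballConnOff_le n (i : ℤ) (j : ℤ) r hjj (d := ℓ) hdd
  have hball2 := hB (2 * n) (by omega) (ℓ + r)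
  have hball3 : C_B * ((((ℓ + r : ℕ) : ℝ) + 1) / ((2 * n : ℕ) : ℝ)) ^ a ≤ C_B * ((ℓ : ℝ) / n) ^ a := by
    refine mul_le_mul_of_nonneg_left (Real.rpow_le_rpow (by positivity) ?_ ha0.le) hCB
    push_cast
    exact ball_arith hn0 h2ℓ
  have hball := hball1.trans (hball2.trans hball3)
  -- combine (on opaque reals)
  have hK := twoPoint_arith (C_A := C_A) hCB hr0 hℓ0 hn0 h6r' a
  generalize hμB : (rcMeasure (finsetGraph (zdGraph 2) (rectangle (2 * n) n)) criticalFKIsingParam 2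
    (halfWiredSide n)).real (ballConnOff n i j r) = μB at hdec hball
  generalize hθi : locArmProb n r i = θi at hdec hθθ
  generalize hθj : locArmProb n r j = θj at hdec hθθ
  have hμB0 : 0 ≤ μB := by rw [← hμB]; exact measureReal_nonneg
  have hb0 : 0 ≤ C_A ^ 2 / r := div_nonneg (sq_nonneg _) hr0.le
  refine hdec.trans ?_
  calc θi * (θj * μB) = (θi * θj) * μB := (mul_assoc _ _ _).symm
    _ ≤ C_A ^ 2 / r * (C_B * ((ℓ : ℝ) / n) ^ a) := mul_le_mul hθθ hball hμB0 hb0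
    _ ≤ 6 * C_A ^ 2 * C_B * (ℓ : ℝ) ^ (a - 1) * (n : ℝ) ^ (-a) := hK

end TwoPoint

/-! ### Summation over the free side -/

section Sums

variable {C_A C_B a : ℝ}

/-- The two-point probability of the sites `(0,i)`, `(0,j)` of the free side of the half, on the
lattice graph. [cite: DuminilCopinHonglerNolin2011, §4, proof of Thm. 1, Step 1] -/
def pairProb (n i j : ℕ) : ℝ :=
  (rcMeasure (finsetGraph (zdGraph 2) (rectangle (2 * n) n)) criticalFKIsingParam 2
    (halfWiredSide n)).real (halfConn n (sideSite n i) ∩ halfConn n (sideSite n j))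

/-- `pairProb` is a probability. [folklore] -/
theorem pairProb_mem_Icc (n i j : ℕ) : 0 ≤ pairProb n i j ∧ pairProb n i j ≤ 1 := by
  haveI := isProbabilityMeasure_rcMeasure (finsetGraph (zdGraph 2) (rectangle (2 * n) n))
    criticalFKIsingParam_mem_Icc two_pos (halfWiredSide n)
  exact ⟨measureReal_nonneg, measureReal_le_one⟩

/-- `pairProb` is symmetric. [folklore] -/
theorem pairProb_comm (n i j : ℕ) : pairProb n i j = pairProb n j i := by
  rw [pairProb, pairProb, Set.inter_comm]

/-- **The pointwise majorant**: `1` near the diagonal (`|i - j| ≤ 2`) and the two-point bound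
`K (|i-j|)^{a-1} n^{-a}`, `K = 6 C_A² C_B`, elsewhere. [cite: DuminilCopinHonglerNolin2011, §4, Prop. 14] -/
theorem pairProb_le_majorant (hCB : 0 ≤ C_B) (ha0 : 0 < a)
    (hA : ∀ N : ℕ, 1 ≤ N →
      (rcMeasure (finsetGraph (zdGraph 2) (rectangle N (2 * N))) criticalFKIsingParam 2
        (threeWired N)).real (threeArm N) ≤ C_A / Real.sqrt N)
    (hB : ∀ N : ℕ, 1 ≤ N → ∀ k : ℕ,
      (rcMeasure (finsetGraph (zdGraph 2) (rectangle N (2 * N))) criticalFKIsingParam 2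
        (threeWired N)).real (threeBallArm N k) ≤ C_B * (((k : ℝ) + 1) / N) ^ a)
    {n : ℕ} (hn : 1 ≤ n) {i j : ℕ} (hi : i ≤ n) (hj : j ≤ n) :
    pairProb n i j ≤
      (if i ≤ j + 2 ∧ j ≤ i + 2 then (1 : ℝ) else 0) +
        (if i + 3 ≤ j then 6 * C_A ^ 2 * C_B * ((j - i : ℕ) : ℝ) ^ (a - 1) * (n : ℝ) ^ (-a) else 0) +
        (if j + 3 ≤ i then 6 * C_A ^ 2 * C_B * ((i - j : ℕ) : ℝ) ^ (a - 1) * (n : ℝ) ^ (-a) else 0) := by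
  have hP := pairProb_mem_Icc n i j
  have hT : ∀ m : ℕ, 0 ≤ 6 * C_A ^ 2 * C_B * (m : ℝ) ^ (a - 1) * (n : ℝ) ^ (-a) := fun m ↦ by
    positivity
  by_cases hnear : i ≤ j + 2 ∧ j ≤ i + 2
  · rw [if_pos hnear]
    have h2 : 0 ≤ (if i + 3 ≤ j then
        6 * C_A ^ 2 * C_B * ((j - i : ℕ) : ℝ) ^ (a - 1) * (n : ℝ) ^ (-a) else 0) := by
      split_ifs <;> [exact hT _; exact le_rfl]
    have h3 : 0 ≤ (if j + 3 ≤ i then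
        6 * C_A ^ 2 * C_B * ((i - j : ℕ) : ℝ) ^ (a - 1) * (n : ℝ) ^ (-a) else 0) := by
      split_ifs <;> [exact hT _; exact le_rfl]
    linarith [hP.2]
  · rw [if_neg hnear]
    by_cases hij : i + 3 ≤ j
    · rw [if_pos hij, if_neg (by omega)]
      have h := real_halfConn_inter_le_rpow hCB ha0 hA hB hn hj hij
      change pairProb n i j ≤ _ at h
      linarith
    · have hji : j + 3 ≤ i := by omega
      rw [if_neg hij, if_pos hji]
      have h := real_halfConn_inter_le_rpow hCB ha0 hA hB hn hi hji
      change pairProb n j i ≤ _ at h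
      rw [pairProb_comm] at h
      linarith

/-- The upper telescoping sum of one row: `Σ_{j > i} (j - i)^{a-1} ≤ n^a / a`. [folklore] -/
theorem sum_upper_le (ha0 : 0 < a) (ha1 : a ≤ 1) {n i : ℕ} (hi : i ≤ n) :
    ∑ j ∈ Finset.range (n + 1),
        (if i + 3 ≤ j then ((j - i : ℕ) : ℝ) ^ (a - 1) else 0) ≤ (n : ℝ) ^ a / a := by
  have hterm0 : ∀ j, 0 ≤ ((j - i : ℕ) : ℝ) ^ (a - 1) := fun j ↦ by positivity
  calc ∑ j ∈ Finset.range (n + 1), (if i + 3 ≤ j then ((j - i : ℕ) : ℝ) ^ (a - 1) else 0)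
      = ∑ j ∈ (Finset.range (n + 1)).filter (fun j ↦ i + 3 ≤ j), ((j - i : ℕ) : ℝ) ^ (a - 1) := by
        rw [Finset.sum_filter]
    _ ≤ ∑ j ∈ Finset.Ico (i + 1) (n + 1), ((j - i : ℕ) : ℝ) ^ (a - 1) := by
        refine Finset.sum_le_sum_of_subset_of_nonneg (fun j hj ↦ ?_) (fun j _ _ ↦ hterm0 j)
        rw [Finset.mem_filter, Finset.mem_range] at hj
        rw [Finset.mem_Ico]
        omega
    _ = ∑ m ∈ Finset.range (n + 1 - (i + 1)), ((m : ℝ) + 1) ^ (a - 1) := by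
        rw [Finset.sum_Ico_eq_sum_range]
        refine Finset.sum_congr rfl fun m _ ↦ ?_
        have : i + 1 + m - i = m + 1 := by omega
        rw [this]
        push_cast
        rfl
    _ ≤ ((n + 1 - (i + 1) : ℕ) : ℝ) ^ a / a := sum_range_rpow_sub_one_le ha0 ha1 _
    _ ≤ (n : ℝ) ^ a / a := by
        refine div_le_div_of_nonneg_right (Real.rpow_le_rpow (Nat.cast_nonneg _) ?_ ha0.le) ha0.le
        exact_mod_cast (by omega : n + 1 - (i + 1) ≤ n)

/-- The lower telescoping sum of one row: `Σ_{j < i} (i - j)^{a-1} ≤ n^a / a`. [folklore] -/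
theorem sum_lower_le (ha0 : 0 < a) (ha1 : a ≤ 1) {n i : ℕ} (hi : i ≤ n) :
    ∑ j ∈ Finset.range (n + 1),
        (if j + 3 ≤ i then ((i - j : ℕ) : ℝ) ^ (a - 1) else 0) ≤ (n : ℝ) ^ a / a := by
  have hterm0 : ∀ j, 0 ≤ ((i - j : ℕ) : ℝ) ^ (a - 1) := fun j ↦ by positivity
  calc ∑ j ∈ Finset.range (n + 1), (if j + 3 ≤ i then ((i - j : ℕ) : ℝ) ^ (a - 1) else 0)
      = ∑ j ∈ (Finset.range (n + 1)).filter (fun j ↦ j + 3 ≤ i), ((i - j : ℕ) : ℝ) ^ (a - 1) := by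
        rw [Finset.sum_filter]
    _ ≤ ∑ j ∈ Finset.range i, ((i - j : ℕ) : ℝ) ^ (a - 1) := by
        refine Finset.sum_le_sum_of_subset_of_nonneg (fun j hj ↦ ?_) (fun j _ _ ↦ hterm0 j)
        rw [Finset.mem_filter, Finset.mem_range] at hj
        rw [Finset.mem_range]
        omega
    _ = ∑ m ∈ Finset.range i, ((m : ℝ) + 1) ^ (a - 1) := by
        rw [← Finset.sum_range_reflect (fun m ↦ ((m : ℝ) + 1) ^ (a - 1)) i]
        refine Finset.sum_congr rfl fun j hj ↦ ?_
        rw [Finset.mem_range] at hj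
        have : i - j = i - 1 - j + 1 := by omega
        rw [this]
        push_cast
        rfl
    _ ≤ (i : ℝ) ^ a / a := sum_range_rpow_sub_one_le ha0 ha1 _
    _ ≤ (n : ℝ) ^ a / a := by
        refine div_le_div_of_nonneg_right (Real.rpow_le_rpow (Nat.cast_nonneg _) ?_ ha0.le) ha0.le
        exact_mod_cast hi

/-- **The sum of one row**: `Σ_{j ≤ n} φ((0,i),(0,j) ↔ side) ≤ 5 + 12 C_A² C_B / a` (for `0 < a ≤ 1`).
[cite: DuminilCopinHonglerNolin2011, §4, proof of Thm. 1, Step 1] -/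
theorem sum_row_le (hCB : 0 ≤ C_B) (ha0 : 0 < a) (ha1 : a ≤ 1)
    (hA : ∀ N : ℕ, 1 ≤ N →
      (rcMeasure (finsetGraph (zdGraph 2) (rectangle N (2 * N))) criticalFKIsingParam 2
        (threeWired N)).real (threeArm N) ≤ C_A / Real.sqrt N)
    (hB : ∀ N : ℕ, 1 ≤ N → ∀ k : ℕ,
      (rcMeasure (finsetGraph (zdGraph 2) (rectangle N (2 * N))) criticalFKIsingParam 2
        (threeWired N)).real (threeBallArm N k) ≤ C_B * (((k : ℝ) + 1) / N) ^ a)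
    {n : ℕ} (hn : 1 ≤ n) {i : ℕ} (hi : i ≤ n) :
    ∑ j ∈ Finset.range (n + 1), pairProb n i j ≤ 5 + 12 * C_A ^ 2 * C_B / a := by
  set K : ℝ := 6 * C_A ^ 2 * C_B with hK
  have hK0 : 0 ≤ K := by positivity
  have hn0 : (0 : ℝ) < n := by exact_mod_cast hn
  have hna : (n : ℝ) ^ (-a) * (n : ℝ) ^ a = 1 := by
    rw [Real.rpow_neg hn0.le, inv_mul_cancel₀ (Real.rpow_pos_of_pos hn0 a).ne']
  -- termwise majorant
  have hmaj : ∀ j ∈ Finset.range (n + 1), pairProb n i j ≤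
      (if i ≤ j + 2 ∧ j ≤ i + 2 then (1 : ℝ) else 0) +
        K * (n : ℝ) ^ (-a) * (if i + 3 ≤ j then ((j - i : ℕ) : ℝ) ^ (a - 1) else 0) +
        K * (n : ℝ) ^ (-a) * (if j + 3 ≤ i then ((i - j : ℕ) : ℝ) ^ (a - 1) else 0) := by
    intro j hj
    rw [Finset.mem_range] at hj
    have h := pairProb_le_majorant hCB ha0 hA hB hn hi (Nat.lt_succ_iff.1 hj) (i := i) (j := j)
    have e2 : (if i + 3 ≤ j then 6 * C_A ^ 2 * C_B * ((j - i : ℕ) : ℝ) ^ (a - 1) * (n : ℝ) ^ (-a) else 0) =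
        K * (n : ℝ) ^ (-a) * (if i + 3 ≤ j then ((j - i : ℕ) : ℝ) ^ (a - 1) else 0) := by
      split_ifs <;> simp [hK]; ring
    have e3 : (if j + 3 ≤ i then 6 * C_A ^ 2 * C_B * ((i - j : ℕ) : ℝ) ^ (a - 1) * (n : ℝ) ^ (-a) else 0) =
        K * (n : ℝ) ^ (-a) * (if j + 3 ≤ i then ((i - j : ℕ) : ℝ) ^ (a - 1) else 0) := by
      split_ifs <;> simp [hK]; ring
    rw [e2, e3] at h
    exact h
  refine (Finset.sum_le_sum hmaj).trans ?_
  rw [Finset.sum_add_distrib, Finset.sum_add_distrib, ← Finset.mul_sum, ← Finset.mul_sum]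
  -- the three sums
  have h1 : ∑ j ∈ Finset.range (n + 1), (if i ≤ j + 2 ∧ j ≤ i + 2 then (1 : ℝ) else 0) ≤ 5 := by
    rw [Finset.sum_boole]
    exact_mod_cast card_filter_near_le i (n + 1)
  have h2 := sum_upper_le ha0 ha1 hi (n := n)
  have h3 := sum_lower_le ha0 ha1 hi (n := n)
  have hKn : 0 ≤ K * (n : ℝ) ^ (-a) := by positivity
  have h2' : K * (n : ℝ) ^ (-a) * ∑ j ∈ Finset.range (n + 1),
      (if i + 3 ≤ j then ((j - i : ℕ) : ℝ) ^ (a - 1) else 0) ≤ K / a := by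
    calc K * (n : ℝ) ^ (-a) * ∑ j ∈ Finset.range (n + 1),
          (if i + 3 ≤ j then ((j - i : ℕ) : ℝ) ^ (a - 1) else 0)
        ≤ K * (n : ℝ) ^ (-a) * ((n : ℝ) ^ a / a) := mul_le_mul_of_nonneg_left h2 hKn
      _ = K / a := by rw [mul_div_assoc', mul_assoc, hna, mul_one]
  have h3' : K * (n : ℝ) ^ (-a) * ∑ j ∈ Finset.range (n + 1),
      (if j + 3 ≤ i then ((i - j : ℕ) : ℝ) ^ (a - 1) else 0) ≤ K / a := by
    calc K * (n : ℝ) ^ (-a) * ∑ j ∈ Finset.range (n + 1),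
          (if j + 3 ≤ i then ((i - j : ℕ) : ℝ) ^ (a - 1) else 0)
        ≤ K * (n : ℝ) ^ (-a) * ((n : ℝ) ^ a / a) := mul_le_mul_of_nonneg_left h3 hKn
      _ = K / a := by rw [mul_div_assoc', mul_assoc, hna, mul_one]
  have : K / a + K / a = 12 * C_A ^ 2 * C_B / a := by rw [hK]; ring
  linarith

/-- **The double sum**: `Σ_{i,j ≤ n} φ((0,i),(0,j) ↔ side) ≤ (10 + 24 C_A² C_B / a) n` (`0 < a ≤ 1`).
[cite: DuminilCopinHonglerNolin2011, §4, proof of Thm. 1, Step 1] -/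
theorem sum_sum_pairProb_le (hCB : 0 ≤ C_B) (ha0 : 0 < a) (ha1 : a ≤ 1)
    (hA : ∀ N : ℕ, 1 ≤ N →
      (rcMeasure (finsetGraph (zdGraph 2) (rectangle N (2 * N))) criticalFKIsingParam 2
        (threeWired N)).real (threeArm N) ≤ C_A / Real.sqrt N)
    (hB : ∀ N : ℕ, 1 ≤ N → ∀ k : ℕ,
      (rcMeasure (finsetGraph (zdGraph 2) (rectangle N (2 * N))) criticalFKIsingParam 2
        (threeWired N)).real (threeBallArm N k) ≤ C_B * (((k : ℝ) + 1) / N) ^ a)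
    {n : ℕ} (hn : 1 ≤ n) :
    ∑ i ∈ Finset.range (n + 1), ∑ j ∈ Finset.range (n + 1), pairProb n i j ≤
      (10 + 24 * C_A ^ 2 * C_B / a) * n := by
  have hrow : ∀ i ∈ Finset.range (n + 1), ∑ j ∈ Finset.range (n + 1), pairProb n i j ≤
      5 + 12 * C_A ^ 2 * C_B / a := fun i hi ↦
    sum_row_le hCB ha0 ha1 hA hB hn (Nat.lt_succ_iff.1 (Finset.mem_range.1 hi))
  refine (Finset.sum_le_sum hrow).trans ?_
  rw [Finset.sum_const, Finset.card_range, nsmul_eq_mul]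
  have hn1 : ((n + 1 : ℕ) : ℝ) ≤ 2 * n := by
    have : (1 : ℝ) ≤ n := by exact_mod_cast hn
    push_cast; linarith
  have hc : 0 ≤ 5 + 12 * C_A ^ 2 * C_B / a := by positivity
  calc ((n + 1 : ℕ) : ℝ) * (5 + 12 * C_A ^ 2 * C_B / a)
      ≤ (2 * n) * (5 + 12 * C_A ^ 2 * C_B / a) := mul_le_mul_of_nonneg_right hn1 hc
    _ = (10 + 24 * C_A ^ 2 * C_B / a) * n := by ring

end Sums

/-! ### RSW from the half-plane arm bounds -/

section Main

/-- **The summed two-point bound from the two arm bounds.** If for the three-sided wired boxes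
`T_N = [0, N] × [0, 2N]` (far side and lateral sides wired, near side free) the critical FK-Ising
measure satisfies (hA) `φ_{T_N}(centre of the free side ↔ wired arc) ≤ C_A/√N` and (hB)
`φ_{T_N}(box of radius k about the centre ↔ wired arc) ≤ C_B ((k+1)/N)^a` for some `a > 0`, then
on the half `H = [0, 2n] × [0, n]` with its far side wired,
`Σ_{i,j ≤ n} φ^{side}_H((0,i) ↔ side, (0,j) ↔ side) ≤ C n`. (The exponent is first reduced to
`min a 1` and the constant raised to `max C_B 1`, which keeps (hB) true since probabilities are at
most one.) [cite: DuminilCopinHonglerNolin2011, §4, Prop. 14, Lemma 15 and proof of Thm. 1, Step 1] -/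
theorem sum_pair_le_of_armBounds
    (hA : ∃ C_A : ℝ, ∀ N : ℕ, 1 ≤ N →
      (fkIsingFiniteMeasure (rectangle N (2 * N)) (threeWired N)).real (threeArm N) ≤
        C_A / Real.sqrt N)
    (hB : ∃ C_B a : ℝ, 0 < a ∧ ∀ N : ℕ, 1 ≤ N → ∀ k : ℕ,
      (fkIsingFiniteMeasure (rectangle N (2 * N)) (threeWired N)).real (threeBallArm N k) ≤
        C_B * (((k : ℝ) + 1) / N) ^ a) :
    ∃ C : ℝ, ∀ n : ℕ, 1 ≤ n →
      ∑ i ∈ Finset.range (n + 1), ∑ j ∈ Finset.range (n + 1),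
        (fkIsingFiniteMeasure (rectangle (2 * n) n) (halfWiredSide n)).real
          (halfConn n (sideSite n i) ∩ halfConn n (sideSite n j)) ≤ C * n := by
  obtain ⟨C_A, hA⟩ := hA
  obtain ⟨C_B, a, ha0, hB⟩ := hB
  -- on the lattice graphs
  have hA' : ∀ N : ℕ, 1 ≤ N →
      (rcMeasure (finsetGraph (zdGraph 2) (rectangle N (2 * N))) criticalFKIsingParam 2
        (threeWired N)).real (threeArm N) ≤ C_A / Real.sqrt N := fun N hN ↦ by
    rw [← fkIsingFiniteMeasure_threeBox_eq]; exact hA N hN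
  have hB'' : ∀ N : ℕ, 1 ≤ N → ∀ k : ℕ,
      (rcMeasure (finsetGraph (zdGraph 2) (rectangle N (2 * N))) criticalFKIsingParam 2
        (threeWired N)).real (threeBallArm N k) ≤ C_B * (((k : ℝ) + 1) / N) ^ a := fun N hN k ↦ by
    rw [← fkIsingFiniteMeasure_threeBox_eq]; exact hB N hN k
  -- `C_B ≥ 0` (test at `N = 1`, `k = 0`)
  have hCB : 0 ≤ C_B := by
    have h := hB'' 1 le_rfl 0
    simp only [Nat.cast_zero, zero_add, Nat.cast_one, div_one, Real.one_rpow, mul_one] at h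
    exact measureReal_nonneg.trans h
  -- reduce the exponent to `a' = min a 1 ≤ 1` and raise the constant to `C' = max C_B 1`
  set a' : ℝ := min a 1 with ha'
  set C' : ℝ := max C_B 1 with hC'
  have ha'0 : 0 < a' := lt_min ha0 one_pos
  have ha'1 : a' ≤ 1 := min_le_right _ _
  have hC'0 : 0 ≤ C' := hCB.trans (le_max_left _ _)
  have hB' : ∀ N : ℕ, 1 ≤ N → ∀ k : ℕ,
      (rcMeasure (finsetGraph (zdGraph 2) (rectangle N (2 * N))) criticalFKIsingParam 2
        (threeWired N)).real (threeBallArm N k) ≤ C' * (((k : ℝ) + 1) / N) ^ a' := by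
    intro N hN k
    haveI := isProbabilityMeasure_rcMeasure (finsetGraph (zdGraph 2) (rectangle N (2 * N)))
      criticalFKIsingParam_mem_Icc two_pos (threeWired N)
    have hx0 : 0 < ((k : ℝ) + 1) / N := by
      have : (0 : ℝ) < N := by exact_mod_cast hN
      positivity
    by_cases hx1 : ((k : ℝ) + 1) / N ≤ 1
    · calc (rcMeasure (finsetGraph (zdGraph 2) (rectangle N (2 * N))) criticalFKIsingParam 2
            (threeWired N)).real (threeBallArm N k)
          ≤ C_B * (((k : ℝ) + 1) / N) ^ a := hB'' N hN k
        _ ≤ C_B * (((k : ℝ) + 1) / N) ^ a' :=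
            mul_le_mul_of_nonneg_left (Real.rpow_le_rpow_of_exponent_ge hx0 hx1 (min_le_left _ _)) hCB
        _ ≤ C' * (((k : ℝ) + 1) / N) ^ a' :=
            mul_le_mul_of_nonneg_right (le_max_left _ _) (Real.rpow_nonneg hx0.le _)
    · push Not at hx1
      calc (rcMeasure (finsetGraph (zdGraph 2) (rectangle N (2 * N))) criticalFKIsingParam 2
            (threeWired N)).real (threeBallArm N k)
          ≤ 1 := measureReal_le_one
        _ ≤ C' * 1 := by rw [mul_one]; exact le_max_right _ _
        _ ≤ C' * (((k : ℝ) + 1) / N) ^ a' :=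
            mul_le_mul_of_nonneg_left (Real.one_le_rpow hx1.le ha'0.le) hC'0
  refine ⟨10 + 24 * C_A ^ 2 * C' / a', fun n hn ↦ ?_⟩
  rw [fkIsingFiniteMeasure_eq_finsetGraph]
  exact sum_sum_pairProb_le hC'0 ha'0 ha'1 hA' hB' hn

/-- **RSW for the critical FK-Ising model from the half-plane arm bounds** (Duminil-Copin–
Hongler–Nolin 2011, Thm. 1 for free boundary conditions = Duminil-Copin–Smirnov 2012, Thm. 3.16,
reduced to its two analytic inputs). In the three-sided wired box `T_N = [0, N] × [0, 2N]` with its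
far side `{x₀ = N}` and lateral sides `{x₁ = 0}`, `{x₁ = 2N}` wired and its near side free (DCHN's
Dobrushin domain `(R_N^β, c_N, d_N)`), assume:

* (hA) the **half-plane one-arm bound** `φ_{T_N}((0, N) ↔ wired arc) ≤ C_A / √N` (DCHN Lemma 12
  with Lemma 11 (i): `P(x ↔ wired arc) ≤ √(c₃/d)` at distance `d` from the wired arc; the case
  `k = 0` of Lemma 15);
* (hB) the **strong half-plane one-arm bound** `φ_{T_N}(box_k(0, N) ↔ wired arc) ≤ C_B ((k+1)/N)^a`
  for *some* `a > 0` (DCHN Lemma 15 gives `a = 1/2`: `P(B_k(x) ↔ wired arc) ≤ c₅ √(k/n)`).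

Then `fkIsing_rsw` holds. Proof: Prop. 13 is the tree's `fkIsing_connection_lower_bound`; the
two-point sum of Prop. 14 is obtained by the decoupling `real_halfConn_inter_le_mul` (two
successive conditionings on the local boxes, in place of DCHN's exploration argument) from (hA),
(hB), and summed (`sum_pair_le_of_armBounds`); the second-moment method concludes
(`fkIsing_rsw_of_pair_sum`). Nothing here assumes `fkIsing_rsw`; (hA) and (hB) are hypotheses,
not named facts. [cite: DuminilCopinHonglerNolin2011, §4, Lemma 15, Props. 13–14, proof of Thm. 1] -/
theorem fkIsing_rsw_of_halfPlaneArmBounds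
    (hA : ∃ C_A : ℝ, ∀ N : ℕ, 1 ≤ N →
      (fkIsingFiniteMeasure (rectangle N (2 * N)) (threeWired N)).real (threeArm N) ≤
        C_A / Real.sqrt N)
    (hB : ∃ C_B a : ℝ, 0 < a ∧ ∀ N : ℕ, 1 ≤ N → ∀ k : ℕ,
      (fkIsingFiniteMeasure (rectangle N (2 * N)) (threeWired N)).real (threeBallArm N k) ≤
        C_B * (((k : ℝ) + 1) / N) ^ a) :
    fkIsing_rsw :=
  fkIsing_rsw_of_pair_sum (sum_pair_le_of_armBounds hA hB)

/-- The one-arm event is contained in the strong one-arm event of radius `0`. [folklore] -/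
theorem threeArm_subset_threeBallArm (N : ℕ) : threeArm N ⊆ threeBallArm N 0 := by
  refine openCrossing_subset_openCrossing ?_ le_rfl
  intro v hv
  rw [Set.mem_singleton_iff] at hv
  subst hv
  rw [mem_centreBall, threeBoxCentre_coe]
  simp

/-- **RSW for the critical FK-Ising model from DCHN's Lemma 15** (the strong half-plane one-arm
estimate, in the `(k+1)`-convention so that `k = 0` is the one-point bound): if there is `C` with
`φ_{T_N}(box_k(0, N) ↔ wired arc) ≤ C √((k+1)/N)` for all `N ≥ 1` and `k`, then `fkIsing_rsw`
(take `a = 1/2` in `fkIsing_rsw_of_halfPlaneArmBounds`, and `k = 0` for the one-arm bound).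
[cite: DuminilCopinHonglerNolin2011, §4, Lemma 15] -/
theorem fkIsing_rsw_of_strongHalfPlaneArm
    (h15 : ∃ C : ℝ, ∀ N : ℕ, 1 ≤ N → ∀ k : ℕ,
      (fkIsingFiniteMeasure (rectangle N (2 * N)) (threeWired N)).real (threeBallArm N k) ≤
        C * Real.sqrt (((k : ℝ) + 1) / N)) :
    fkIsing_rsw := by
  obtain ⟨C, hC⟩ := h15
  refine fkIsing_rsw_of_halfPlaneArmBounds ⟨C, fun N hN ↦ ?_⟩ ⟨C, 1 / 2, one_half_pos, fun N hN k ↦ ?_⟩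
  · haveI : IsFiniteMeasure (fkIsingFiniteMeasure (rectangle N (2 * N)) (threeWired N)) := by
      rw [fkIsingFiniteMeasure_threeBox_eq]
      haveI := isProbabilityMeasure_rcMeasure (finsetGraph (zdGraph 2) (rectangle N (2 * N)))
        criticalFKIsingParam_mem_Icc two_pos (threeWired N)
      infer_instance
    calc (fkIsingFiniteMeasure (rectangle N (2 * N)) (threeWired N)).real (threeArm N)
        ≤ (fkIsingFiniteMeasure (rectangle N (2 * N)) (threeWired N)).real (threeBallArm N 0) :=
          measureReal_mono (threeArm_subset_threeBallArm N) (measure_ne_top _ _)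
      _ ≤ C * Real.sqrt ((((0 : ℕ) : ℝ) + 1) / N) := hC N hN 0
      _ = C / Real.sqrt N := by
          rw [Nat.cast_zero, zero_add, Real.sqrt_div zero_le_one, Real.sqrt_one, mul_one_div]
  · rw [← Real.sqrt_eq_rpow]
    exact hC N hN k

end Main

end Literature.Probability.LatticeModels
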